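import Mathlib
import Summits.CriticalPhenomena.CardyFormulaZ2.Theses.CardyMagicRigidity
import Summits.CriticalPhenomena.CardyFormulaZ2.Theorems.CardyMagicRigidityDefs
import Literature.Probability.RandomPlanarGeometry.NestingTransform
import Literature.Probability.Percolation.FullPlaneCNL
import HarnessLib

/-!
# Base cases of stub S5 · `Fusion` (line `ring-cloud-tomography`, crux `NestingRigidity`)

Crux `Summit.CriticalPhenomena.CardyFormulaZ2.Theses.CardyMagicRigidity.NestingRigidity`
(stmt-CriticalPhenomena-4835), line `ring-cloud-tomography`, registered stub `stub_fusion : Fusion`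
with `Fusion := zEns.CloudLaw → tEns.CloudLaw → TowerStatisticsAgree → NestingStatisticsAgree`
(vocabulary: `Theorems/CardyMagicRigidityDefs.lean`).  The layers `n ≥ 2` of `NestingStatisticsAgree`
(and already the off-centre one-disc layer) are research-level; this file settles, sorry-free, the two
layers of `NestingStatisticsAgree` that ARE formally reducible:

* `nestingStatisticsAgree_zero` — no discs (`n = 0`): the pattern event
  `∀ S : Finset (Fin 0), S.Nonempty → …` is vacuous, both probabilities are `1`, the difference is `0`.
* `nestingStatisticsAgree_one_centered` — one disc centred at the window centre (`n = 1`, `z 0 = 0`):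
  the only nonempty `S` is `univ`, the avoidance clause of `patternCount` is vacuous and
  `patternCount c (fun _ ↦ 0) r R univ = towerCount c 0 (r 0) R` (`patternCount_univ_centered`); for
  `r 0 < R` the claim is `TowerStatisticsAgree` at `x = 0`, `m = 1`; for `R ≤ r 0` no loop qualifies on
  either lattice (`towerCount_eq_zero_of_le`: a loop with trace in `B(0, R) ⊆ B̄(0, r 0) ⊆ {W ≠ 0}`
  would wind around a point of its own trace, where `W = 0` by `Curve.wind_of_mem_range`), so both
  events are the same deterministic event and the difference is `0`.

Also recorded (statement stress-test of S5): `patternCount_eq_zero_of_le` — a disc sticking out of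
the window (`R ≤ ‖z i‖ + r i`) is surrounded by no loop of the window, on every configuration.

Main theorem (registered sub-goal): `nestingStatisticsAgree_one_centered`.
-/

noncomputable section

open MeasureTheory Set Filter Metric
open scoped Real Topology BigOperators

namespace Summit.CriticalPhenomena.CardyFormulaZ2.Cruxes.NestingRigidity.RingCloudTomography

open Literature.Probability.RandomPlanarGeometry Literature.Probability.Percolation
  Literature.Probability.LatticeModels

/-! ## The two lattice measures are probability measures

(stated as theorems, used via `haveI`; no global instances are registered) -/

/-- The critical bond-`ℤ²` percolation measure of `zEns` is a probability measure. -/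
theorem isProbabilityMeasure_zEns_P : IsProbabilityMeasure zEns.P :=
  inferInstanceAs (IsProbabilityMeasure (bondPercolation (zdGraph 2) half))

/-- The critical site-`𝕋` percolation measure of `tEns` is a probability measure. -/
theorem isProbabilityMeasure_tEns_P : IsProbabilityMeasure tEns.P :=
  inferInstanceAs (IsProbabilityMeasure (triSitePercolation half))

/-! ## Winding numbers vanish on the trace -/

/-- The winding number of an unbased loop is `0` at every point of its own trace (junk value of
`Curve.wind` on the trace, transported through the quotients). -/
theorem unbasedLoop_wind_of_mem_range (u : UnbasedLoop ℂ) {z : ℂ} (hz : z ∈ u.range) :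
    u.wind z = 0 := by
  obtain ⟨ℓ, rfl⟩ := UnbasedLoop.mk_surjective u
  obtain ⟨c, hc⟩ := ℓ
  obtain ⟨γ, rfl⟩ := CurveClass.surjective_mk c
  rw [UnbasedLoop.range_mk] at hz
  rw [UnbasedLoop.wind_mk]
  change z ∈ (CurveClass.mk γ).range at hz
  change CurveClass.wind (CurveClass.mk γ) z = 0
  rw [CurveClass.range_mk] at hz
  rw [CurveClass.wind_mk]
  exact Curve.wind_of_mem_range hz

/-- No loop winds around every point of its own (nonempty) trace. -/
theorem not_range_subset_wind_ne_zero (u : UnbasedLoop ℂ) : ¬ u.range ⊆ {z | u.wind z ≠ 0} := by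
  intro h
  obtain ⟨z, hz⟩ := u.range_nonempty
  exact h hz (unbasedLoop_wind_of_mem_range u hz)

/-! ## Degenerate windows: `R ≤ ρ` -/

/-- If the window radius does not exceed the disc radius, the tower above `x` is empty on EVERY
configuration: a loop with trace in `B(x, R) ⊆ B̄(x, ρ) ⊆ {W ≠ 0}` would wind around its own trace. -/
theorem towerCount_eq_zero_of_le (c : LoopConfig ℂ) (x : ℂ) {ρ R : ℝ} (h : R ≤ ρ) :
    towerCount c x ρ R = 0 := by
  unfold towerCount
  convert Set.ncard_empty (UnbasedLoop ℂ)
  refine Set.eq_empty_of_forall_notMem fun u hu ↦ ?_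
  obtain ⟨-, hwind, hrange⟩ := hu
  exact not_range_subset_wind_ne_zero u
    (hrange.trans ((ball_subset_closedBall.trans (closedBall_subset_closedBall h)).trans hwind))

/-! ## Degenerate windows: a disc sticking out of `B(0, R)` -/

/-- The interior of a loop lies in any ball containing its trace: the winding number of an unbased
loop with trace in `B(w, ρ)` vanishes at every point at distance `≥ ρ` from `w`
(`Curve.wind_eq_zero_of_subset_ball`, transported through the quotients). -/
theorem unbasedLoop_wind_eq_zero_of_subset_ball (u : UnbasedLoop ℂ) {w z : ℂ} {ρ : ℝ}
    (hu : u.range ⊆ ball w ρ) (hz : ρ ≤ dist z w) : u.wind z = 0 := by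
  obtain ⟨ℓ, rfl⟩ := UnbasedLoop.mk_surjective u
  obtain ⟨c, hc⟩ := ℓ
  obtain ⟨γ, rfl⟩ := CurveClass.surjective_mk c
  rw [UnbasedLoop.range_mk] at hu
  rw [UnbasedLoop.wind_mk]
  change (CurveClass.mk γ).range ⊆ _ at hu
  change CurveClass.wind (CurveClass.mk γ) z = 0
  rw [CurveClass.range_mk] at hu
  rw [CurveClass.wind_mk]
  exact Curve.wind_eq_zero_of_subset_ball hu hz

/-- **Discs sticking out of the window are never surrounded.** If `i ∈ S`, `0 ≤ r i` and
`R ≤ ‖z i‖ + r i` (the closed disc `B̄(z i, r i)` is not inside the open window `B(0, R)`), then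
`patternCount c z r R S = 0` on EVERY configuration: the boundary point of the disc radially farthest
from `0` has norm `‖z i‖ + r i ≥ R`, so every loop with trace in `B(0, R)` has winding number `0`
there. Hence for such data the pattern events with `S ∋ i` are the same deterministic event on both
lattices. -/
theorem patternCount_eq_zero_of_le {n : ℕ} (c : LoopConfig ℂ) (z : Fin n → ℂ) (r : Fin n → ℝ)
    (R : ℝ) {S : Finset (Fin n)} {i : Fin n} (hi : i ∈ S) (hr : 0 ≤ r i)
    (hR : R ≤ ‖z i‖ + r i) : patternCount c z r R S = 0 := by
  unfold patternCount
  convert Set.ncard_empty (UnbasedLoop ℂ)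
  refine Set.eq_empty_of_forall_notMem fun u hu ↦ ?_
  obtain ⟨-, hrange, hwind, -⟩ := hu
  -- a point of the closed disc at distance `≥ R` from the window centre
  obtain ⟨w, hw1, hw2⟩ : ∃ w : ℂ, w ∈ closedBall (z i) (r i) ∧ R ≤ dist w 0 := by
    by_cases hz0 : z i = 0
    · refine ⟨(r i : ℂ), ?_, ?_⟩
      · rw [mem_closedBall, hz0, dist_zero_right, Complex.norm_real, Real.norm_eq_abs,
          abs_of_nonneg hr]
      · rw [dist_zero_right, Complex.norm_real, Real.norm_eq_abs, abs_of_nonneg hr]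
        simpa [hz0] using hR
    · have hzpos : 0 < ‖z i‖ := norm_pos_iff.2 hz0
      refine ⟨(((‖z i‖ + r i) / ‖z i‖ : ℝ) : ℂ) * z i, ?_, ?_⟩
      · rw [mem_closedBall, dist_eq_norm,
          show (((‖z i‖ + r i) / ‖z i‖ : ℝ) : ℂ) * z i - z i = ((r i / ‖z i‖ : ℝ) : ℂ) * z i by
            rw [add_div, div_self hzpos.ne']; push_cast; ring,
          norm_mul, Complex.norm_real, Real.norm_eq_abs, abs_of_nonneg (div_nonneg hr hzpos.le),
          div_mul_cancel₀ _ hzpos.ne']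
      · rw [dist_zero_right, norm_mul, Complex.norm_real, Real.norm_eq_abs,
          abs_of_nonneg (div_nonneg (add_nonneg hzpos.le hr) hzpos.le), div_mul_cancel₀ _ hzpos.ne']
        exact hR
  exact hwind i hi hw1 (unbasedLoop_wind_eq_zero_of_subset_ball u hrange hw2)

/-! ## One centred disc: pattern count = tower count -/

/-- The only nonempty finset of `Fin 1` is `univ`. -/
theorem finset_fin_one_eq_univ {S : Finset (Fin 1)} (hS : S.Nonempty) : S = Finset.univ := by
  obtain ⟨i, hi⟩ := hS
  refine Finset.eq_univ_of_forall fun j ↦ ?_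
  rwa [Subsingleton.elim j i]

/-- For a single disc centred at the window centre `0`, the pattern count of `S = univ` is the tower
count above `0`: the avoidance clause `∀ i ∉ univ, …` is vacuous and the two windows coincide. -/
theorem patternCount_univ_centered (c : LoopConfig ℂ) (r : Fin 1 → ℝ) (R : ℝ) :
    patternCount c (fun _ : Fin 1 ↦ (0 : ℂ)) r R Finset.univ = towerCount c 0 (r 0) R := by
  unfold patternCount towerCount
  congr 1
  ext u
  simp only [mem_setOf_eq, Finset.mem_univ, forall_const, not_true_eq_false, IsEmpty.forall_iff,
    and_true, Fin.forall_fin_one]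
  tauto

/-- For a single disc centred at `0`, the pattern event `∀ S ≠ ∅, N_S = k S` is the tower event
`N_0(r 0, R) = k univ`. -/
theorem setOf_pattern_one_centered (E : LoopEnsemble) (δ : ℝ) (r : Fin 1 → ℝ) (R : ℝ)
    (k : Finset (Fin 1) → ℕ) :
    {ω | ∀ S : Finset (Fin 1), S.Nonempty → patternCount (E.X δ ω) (fun _ ↦ 0) r R S = k S} =
      {ω | ∀ _j : Fin 1, towerCount (E.X δ ω) 0 (r 0) R = k Finset.univ} := by
  ext ω
  simp only [mem_setOf_eq, forall_const]
  constructor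
  · intro h
    rw [← patternCount_univ_centered]
    exact h Finset.univ ⟨0, Finset.mem_univ _⟩
  · intro h S hS
    rw [finset_fin_one_eq_univ hS, patternCount_univ_centered]
    exact h

/-! ## The two base cases of `NestingStatisticsAgree` -/

/-- **Base case `n = 0` of `NestingStatisticsAgree`.** With no discs there is no nonempty `S`, the
pattern event is the sure event on both lattices, and the difference of probabilities is identically
`1 − 1 = 0`. -/
theorem nestingStatisticsAgree_zero (z : Fin 0 → ℂ) (r : Fin 0 → ℝ) (R : ℝ)
    (k : Finset (Fin 0) → ℕ) :
    Tendsto (fun δ : ℝ ↦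
      (zEns.P {ω | ∀ S : Finset (Fin 0), S.Nonempty → patternCount (zEns.X δ ω) z r R S = k S}).toReal -
        (tEns.P {ω | ∀ S : Finset (Fin 0), S.Nonempty →
          patternCount (tEns.X δ ω) z r R S = k S}).toReal) (𝓝[>] 0) (𝓝 0) := by
  haveI := isProbabilityMeasure_zEns_P
  haveI := isProbabilityMeasure_tEns_P
  have h0 : ∀ S : Finset (Fin 0), ¬ S.Nonempty := fun S ⟨i, _⟩ ↦ i.elim0
  have hE : ∀ (E : LoopEnsemble) (δ : ℝ),
      {ω | ∀ S : Finset (Fin 0), S.Nonempty → patternCount (E.X δ ω) z r R S = k S} = univ :=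
    fun E δ ↦ Set.eq_univ_of_forall fun ω S hS ↦ (h0 S hS).elim
  simp only [hE, measure_univ, ENNReal.toReal_one, sub_self]
  exact tendsto_const_nhds

/-- **Base case `n = 1`, centred disc, of `NestingStatisticsAgree`** (the formally reducible layer of
stub S5 · `Fusion`). For one disc `B̄(0, r 0)` centred at the window centre, the pattern event is the
tower event `N_0(r 0, R) = k univ` (`setOf_pattern_one_centered`); if `r 0 < R` the claim is the
instance `x = 0`, `m = 1` of `TowerStatisticsAgree`; if `R ≤ r 0` the tower is empty on every
configuration of either lattice (`towerCount_eq_zero_of_le`), both events are the same deterministic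
event `0 = k univ`, and the difference of probabilities vanishes identically. -/
theorem nestingStatisticsAgree_one_centered : TowerStatisticsAgree →
    ∀ (r : Fin 1 → ℝ) (R : ℝ) (k : Finset (Fin 1) → ℕ), 0 < r 0 →
      Tendsto (fun δ : ℝ ↦
        (zEns.P {ω | ∀ S : Finset (Fin 1), S.Nonempty →
            patternCount (zEns.X δ ω) (fun _ ↦ 0) r R S = k S}).toReal -
          (tEns.P {ω | ∀ S : Finset (Fin 1), S.Nonempty →
            patternCount (tEns.X δ ω) (fun _ ↦ 0) r R S = k S}).toReal) (𝓝[>] 0) (𝓝 0) := by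
  intro hT r R k hr
  haveI := isProbabilityMeasure_zEns_P
  haveI := isProbabilityMeasure_tEns_P
  simp only [setOf_pattern_one_centered]
  rcases lt_or_ge (r 0) R with hR | hR
  · exact hT 0 1 (fun _ ↦ r 0) R (fun _ ↦ k Finset.univ) (fun _ ↦ hr) fun _ ↦ hR
  · simp only [towerCount_eq_zero_of_le _ _ hR, forall_const]
    by_cases hk : 0 = k Finset.univ
    · simp only [hk, setOf_true, measure_univ, ENNReal.toReal_one, sub_self]
      exact tendsto_const_nhds
    · simp only [hk, setOf_false, measure_empty, ENNReal.toReal_zero, sub_self]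
      exact tendsto_const_nhds

end Summit.CriticalPhenomena.CardyFormulaZ2.Cruxes.NestingRigidity.RingCloudTomography

end
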